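/-
COR-CM (cell pub-hodgecm2, stage 2 of the Hodge ladder) — count-neutral KERNEL COMBINATORICS «the binary tetrahedral group SL(2,3)», part IV: the MODEL
(seat prover-pub-hodgecm2-b23-g53-0, binder prover b23, gen 53; claim HOME/INBOX.md l.24246, NAME ASK l.24300, lead ACK l.24306).  Bookkeeping definitions
with bodies (`ρA`, `twA`, `twAinv`, `twAEquiv`, `translA`, `translAHom`, `σA`, `plA`) + theorems — gen 45ʼs `Census/OcticProductModel.lean` with the diagonal
translation `twH₄ (0, σ)` replaced by the SHEARED translation `twA σ` (translate every coordinate by `σ` AND rotate the coordinates `1 → 3 → 2 → 1`);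
on gen 44ʼs label-level lane `Census/QuarticInversion*` BY NAME; no `decide` beyond closed identities in `Fin 4`, no certificate, no named fact, no `sorry`.
`Interfaces.lean` (C1), every E term, B01, `Transposition/*`, `PortJoin/*`, `D2Bridge/*` untouched.
HONEST FRAMING: `HC_CM` is NOT proved, here or anywhere in the tree; nothing here is a period, a count of record or a headline.
T5: n/a-class (no hypothesis binders beyond `Odd |A|`); checker: self.
-/
import Summits.HodgeConjecture.CorCM.Census.OcticProductModel

/-!
# The binary tetrahedral group, IV: the model — the sheared translation `twA` on `Ty₄ A`

THE MODEL of `SL(2,3) = Q₈ ⋊ ℤ/3` (and of `Q₈ ⋊ A` for a cyclic `A` acting through a `3`-cycle of `i, j, k`): labels `Θ = ((ψ₀, ψ₁), (ψ₂, ψ₃)) ∈ Ty₄ A`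
read on the cosets `C x` (`x ∈ {1, i, k, j}`) of the cyclic subgroup `C = ⟨c⟩ × A`, coordinate `ψ_x (e) = [aᵉ x ∈ Φ]`.  The quaternion units move the
labels by gen 45ʼs `twZ 1` (`i`) and gen 44ʼs `twT` (`k`), `c` by `conj₄`; the new generator `a` moves them by the **sheared translation**
`twA σ ((ψ₀, ψ₁), (ψ₂, ψ₃)) = ((ψ₀·σ, ψ₂·σ), (ψ₃·σ, ψ₁·σ))` (`ψ·σ = tw (0, σ) ψ`): translate every coordinate and rotate the coordinates `1 → 3 → 2 → 1`
(`a i a⁻¹ = j`, `a j a⁻¹ = k`, `a k a⁻¹ = i` read contravariantly).  Part V (`…Dictionary`) proves `ty (Φ·a) = twA 1 (ty Φ)` for a binary tetrahedral datum.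
THIS FILE (label level, every `A`, every shear `σ`):
* §1 `twA`, its inverse, `coord_twA`, commutation with `conj₄`/`twH₄ (ζ, 0)`; the translate `translA` of exponent vectors.
* §2 `translA` preserves `hodge₄` (through the four slice marginals) and `pairs₄`.
* §3 places move by `plA σ (k, i) = (σA k, i − σ)`; flips and faces are `twA`-equivariant; `faceSet₄` is stable.
* §4 the potential `pot₄`, the corners and the halves move along; reducing pairs stay reducing (`reducing_twA`).
All [folklore] bookkeeping over [Pohlmann1968, Thm 1].

## References
* [Pohlmann1968] H. Pohlmann, Algebraic cycles on abelian varieties of complex multiplication type, Ann. of Math. 88 (1968), Thm 1.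
* [Milne1999] J. S. Milne, Lefschetz motives and the Tate conjecture, Compositio Math. 117 (1999), Prop. 2.1, p. 54.
-/

namespace Summit.HodgeConjecture.CorCM.Census.BinaryTetrahedral

open Finset
open Summit.HodgeConjecture.CorCM.Census.OddSliceFacesModel
open Summit.HodgeConjecture.CorCM.Census.OddSliceFacesSquares (clsTy clsTy_tw)
open Summit.HodgeConjecture.CorCM.Census.QuarticInversion

noncomputable section

/-! ## §1 The sheared translation -/

section Labels

variable (A : Type) [AddCommGroup A] [DecidableEq A]

/-- **The coordinate rotation of `a`**: the new coordinate `k` is read off the old coordinate `ρA k` (`0 ↦ 0`, `1 ↦ 2`, `2 ↦ 3`, `3 ↦ 1`). [folklore] -/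
def ρA : Fin 4 → Fin 4 := ![0, 2, 3, 1]

/-- **Where a coordinate goes under `a`**: the inverse rotation (`0 ↦ 0`, `1 ↦ 3`, `2 ↦ 1`, `3 ↦ 2`). [folklore] -/
def σA : Fin 4 → Fin 4 := ![0, 3, 1, 2]

/-- `ρA ∘ σA = id`. [folklore] -/
@[simp] theorem ρA_σA (k : Fin 4) : ρA (σA k) = k := by fin_cases k <;> rfl

/-- `σA ∘ ρA = id`. [folklore] -/
@[simp] theorem σA_ρA (k : Fin 4) : σA (ρA k) = k := by fin_cases k <;> rfl

/-- `σA` is injective. [folklore] -/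
theorem σA_injective : Function.Injective σA := fun k l h => by rw [← ρA_σA k, h, ρA_σA]

/-- **The sheared translation** (the motion of `a`): translate every coordinate by `σ` and rotate the coordinates `1 → 3 → 2 → 1`. [folklore] -/
def twA (σ : A) (Θ : Ty₄ A) : Ty₄ A := ((tw A (0, σ) Θ.1.1, tw A (0, σ) Θ.2.1), (tw A (0, σ) Θ.2.2, tw A (0, σ) Θ.1.2))

/-- The motion of `a⁻¹`. [folklore] -/
def twAinv (σ : A) (Θ : Ty₄ A) : Ty₄ A := ((tw A (0, -σ) Θ.1.1, tw A (0, -σ) Θ.2.2), (tw A (0, -σ) Θ.1.2, tw A (0, -σ) Θ.2.1))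

omit [DecidableEq A] in
/-- `(0, -σ) = -(0, σ)` in `ℤ/2 × A`. [folklore] -/
private theorem zero_neg (σ : A) : ((0 : ZMod 2), -σ) = -((0 : ZMod 2), σ) := by
  rw [Prod.neg_mk, neg_zero]

omit [DecidableEq A] in
/-- `a⁻¹ a = 1` on labels. [folklore] -/
@[simp] theorem twAinv_twA (σ : A) (Θ : Ty₄ A) : twAinv A σ (twA A σ Θ) = Θ := by
  obtain ⟨⟨ψ₀, ψ₁⟩, ⟨ψ₂, ψ₃⟩⟩ := Θ
  simp only [twA, twAinv, zero_neg, tw_neg_tw]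

omit [DecidableEq A] in
/-- `a a⁻¹ = 1` on labels. [folklore] -/
@[simp] theorem twA_twAinv (σ : A) (Θ : Ty₄ A) : twA A σ (twAinv A σ Θ) = Θ := by
  obtain ⟨⟨ψ₀, ψ₁⟩, ⟨ψ₂, ψ₃⟩⟩ := Θ
  simp only [twA, twAinv, zero_neg, tw_tw_neg]

omit [DecidableEq A] in
/-- **The coordinates of a moved label**: `coord k (twA σ Θ) = (coord (ρA k) Θ)·σ`. [folklore] -/
theorem coord_twA (σ : A) (k : Fin 4) (Θ : Ty₄ A) : coord A k (twA A σ Θ) = tw A (0, σ) (coord A (ρA k) Θ) := by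
  obtain ⟨⟨ψ₀, ψ₁⟩, ⟨ψ₂, ψ₃⟩⟩ := Θ
  fin_cases k <;> rfl

omit [DecidableEq A] in
/-- `a` commutes with the central translations `twH₄ (ζ, 0)` (in particular with `conj₄`). [folklore] -/
theorem twA_twH₄ (σ : A) (ζ : ZMod 2) (Θ : Ty₄ A) : twA A σ (twH₄ A (ζ, 0) Θ) = twH₄ A (ζ, 0) (twA A σ Θ) := by
  obtain ⟨⟨ψ₀, ψ₁⟩, ⟨ψ₂, ψ₃⟩⟩ := Θ
  simp only [twA, twH₄, DicyclicTwist.twH, tw_tw, Prod.mk_add_mk, add_zero, zero_add]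

omit [DecidableEq A] in
/-- **`a³` is the plain translation by `3σ`**: `twA σ (twA σ (twA σ Θ)) = twH₄ (0, σ + σ + σ) Θ`. [folklore] -/
theorem twA_twA_twA (σ : A) (Θ : Ty₄ A) : twA A σ (twA A σ (twA A σ Θ)) = twH₄ A (0, σ + σ + σ) Θ := by
  obtain ⟨⟨ψ₀, ψ₁⟩, ⟨ψ₂, ψ₃⟩⟩ := Θ
  simp only [twA, twH₄, DicyclicTwist.twH, tw_tw, Prod.mk_add_mk, add_zero]

/-- The sheared translation as a permutation of the labels. [folklore] -/
def twAEquiv (σ : A) : Ty₄ A ≃ Ty₄ A where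
  toFun := twA A σ
  invFun := twAinv A σ
  left_inv := twAinv_twA A σ
  right_inv := twA_twAinv A σ

/-- Translate of an exponent vector by `a`. [folklore] -/
def translA (σ : A) (v : Ty₄ A → ℤ) : Ty₄ A → ℤ := fun Θ => v (twAinv A σ Θ)

/-- Translation by `a` as a `ℤ`-linear map. [folklore] -/
def translAHom (σ : A) : (Ty₄ A → ℤ) →ₗ[ℤ] (Ty₄ A → ℤ) where
  toFun := translA A σ
  map_add' _ _ := rfl
  map_smul' _ _ := rfl

omit [DecidableEq A] in
/-- `translAHom` is `translA`. [folklore] -/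
@[simp] theorem translAHom_apply (σ : A) (v : Ty₄ A → ℤ) : translAHom A σ v = translA A σ v := rfl

end Labels

/-! ## §2 The sheared translation preserves the Hodge lattice and the pairs -/

section Hodge

variable (A : Type) [AddCommGroup A] [Fintype A] [DecidableEq A]

omit [DecidableEq A] in
/-- Translate of a unit vector by `a`. [folklore] -/
theorem translA_single (σ : A) (Θ : Ty₄ A) (n : ℤ) : translA A σ (Pi.single Θ n) = Pi.single (twA A σ Θ) n := by
  classical
  funext Φ
  have hiff : twAinv A σ Φ = Θ ↔ Φ = twA A σ Θ := by
    constructor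
    · intro h; rw [← h, twA_twAinv]
    · intro h; rw [h, twAinv_twA]
  simp only [translA, Pi.single_apply, hiff]

/-- **The slice marginals of a translate are translated slice marginals of the rotated coordinates.** [folklore] -/
theorem sliceMarg_translA (σ : A) (k : Fin 4) (v : Ty₄ A → ℤ) :
    sliceMarg A k (translA A σ v) = transl A (0, σ) (sliceMarg A (ρA k) v) := by
  classical
  -- both sides are `ℤ`-linear in `v`; check on unit vectors
  suffices h : ((sliceMarg A k).comp (translAHom A σ)) = (translHom A (0, σ)).comp (sliceMarg A (ρA k)) by
    have := LinearMap.congr_fun h v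
    simpa only [LinearMap.comp_apply, translAHom_apply, translHom_apply] using this
  apply LinearMap.pi_ext'
  intro Θ
  apply LinearMap.ext_ring
  simp only [LinearMap.comp_apply, LinearMap.single_apply, translAHom_apply, translHom_apply]
  rw [show (Pi.single Θ (1 : ℤ) : Ty₄ A → ℤ) = Pi.single Θ 1 from rfl, translA_single, sliceMarg_single, sliceMarg_single, coord_twA,
    transl_single]

/-- **`H₄` is stable under the sheared translation.** [folklore] -/
theorem translA_mem (σ : A) {v : Ty₄ A → ℤ} (hv : v ∈ hodge₄ A) : translA A σ v ∈ hodge₄ A := by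
  rw [mem_hodge₄_iff_sliceMarg] at hv ⊢
  intro k
  rw [sliceMarg_translA]
  exact transl_mem A (hv (ρA k)) (0, σ)

omit [Fintype A] [DecidableEq A] in
/-- Conjugation commutes with the sheared translation. [folklore] -/
theorem twA_conj₄ (σ : A) (Θ : Ty₄ A) : twA A σ (conj₄ A Θ) = conj₄ A (twA A σ Θ) := by
  rw [conj₄_eq_twH₄, conj₄_eq_twH₄, twA_twH₄]

omit [DecidableEq A] in
/-- An `a`-translate of a pair is a pair. [folklore] -/
theorem translA_pairVec₄ (σ : A) (Θ : Ty₄ A) : translA A σ (pairVec₄ A Θ) = pairVec₄ A (twA A σ Θ) := by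
  classical
  show translAHom A σ (Pi.single Θ 1 + Pi.single (conj₄ A Θ) 1) = Pi.single (twA A σ Θ) 1 + Pi.single (conj₄ A (twA A σ Θ)) 1
  rw [map_add, translAHom_apply, translAHom_apply, translA_single, translA_single, twA_conj₄]

omit [DecidableEq A] in
/-- **`pairs₄` is stable under the sheared translation.** [folklore] -/
theorem translA_mem_pairs₄ (σ : A) {v : Ty₄ A → ℤ} (hv : v ∈ pairs₄ A) : translA A σ v ∈ pairs₄ A := by
  rw [← translAHom_apply]
  refine Submodule.span_induction (p := fun w _ => translAHom A σ w ∈ pairs₄ A) ?_ ?_ ?_ ?_ hv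
  · rintro _ ⟨Θ, rfl⟩
    rw [translAHom_apply, translA_pairVec₄]
    exact Submodule.subset_span ⟨_, rfl⟩
  · rw [map_zero]; exact Submodule.zero_mem _
  · intro x y _ _ hx hy; rw [map_add]; exact Submodule.add_mem _ hx hy
  · intro n x _ hx; rw [map_smul]; exact Submodule.smul_mem _ n hx

end Hodge

/-! ## §3 Flips and faces are `a`-equivariant -/

section Faces

variable (A : Type) [AddCommGroup A] [DecidableEq A]

/-- The action of `a` on places: `(k, i) ↦ (σA k, i − σ)`. [folklore] -/
def plA (σ : A) (p : Pl A) : Pl A := (σA p.1, p.2 - σ)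

omit [DecidableEq A] in
/-- `plA` is injective. [folklore] -/
theorem plA_injective (σ : A) : Function.Injective (plA A σ) := fun p q h => by
  obtain ⟨k, i⟩ := p
  obtain ⟨l, j⟩ := q
  simp only [plA, Prod.mk.injEq] at h
  obtain ⟨h1, h2⟩ := h
  rw [σA_injective h1, sub_left_injective h2]

/-- **Flips are `a`-equivariant**: `twA σ (Θ^{(p)}) = (twA σ Θ)^{(a·p)}`. [folklore] -/
theorem twA_flipAt (σ : A) (p : Pl A) (Θ : Ty₄ A) : twA A σ (flipAt A p Θ) = flipAt A (plA A σ p) (twA A σ Θ) := by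
  obtain ⟨k, i⟩ := p
  obtain ⟨⟨ψ₀, ψ₁⟩, ⟨ψ₂, ψ₃⟩⟩ := Θ
  fin_cases k <;> simp [flipAt, plA, σA, twA, addAt, tw_add_delta]

variable [Fintype A]

/-- **An `a`-translate of a face is the face through the moved label at the moved places.** [folklore] -/
theorem translA_faceVec₄ (σ : A) (Θ : Ty₄ A) (p q : Pl A) :
    translA A σ (faceVec₄ A Θ p q) = faceVec₄ A (twA A σ Θ) (plA A σ p) (plA A σ q) := by
  show translAHom A σ (faceVec₄ A Θ p q) = _
  unfold faceVec₄
  simp only [map_add, translAHom_apply, translA_single, twA_conj₄, twA_flipAt]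

/-- **`faceSet₄` is stable under the sheared translation.** [folklore] -/
theorem translA_mem_faceSet₄ (σ : A) {v : Ty₄ A → ℤ} (hv : v ∈ faceSet₄ A) : translA A σ v ∈ faceSet₄ A := by
  obtain ⟨Θ, p, q, hpq, rfl⟩ := hv
  exact ⟨_, _, _, fun h => hpq (plA_injective A σ h), translA_faceVec₄ A σ Θ p q⟩

end Faces

/-! ## §4 Potential, corners and halves under the sheared translation -/

section Potential

variable (A : Type) [AddCommGroup A] [Fintype A] [DecidableEq A]

omit [DecidableEq A] in
/-- The potential is invariant under the sheared translation. [folklore] -/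
theorem pot₄_twA (σ : A) (Θ : Ty₄ A) : pot₄ A (twA A σ Θ) = pot₄ A Θ := by
  obtain ⟨⟨ψ₀, ψ₁⟩, ⟨ψ₂, ψ₃⟩⟩ := Θ
  show clsTy A (tw A (0, σ) ψ₀) + clsTy A (tw A (0, σ) ψ₂) + clsTy A (tw A (0, σ) ψ₃) + clsTy A (tw A (0, σ) ψ₁) =
    clsTy A ψ₀ + clsTy A ψ₁ + clsTy A ψ₂ + clsTy A ψ₃
  rw [clsTy_tw, clsTy_tw, clsTy_tw, clsTy_tw]
  ring

omit [AddCommGroup A] [Fintype A] in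
/-- The corners of a moved face are the moved corners. [folklore] -/
theorem corner_twA [AddCommGroup A] (σ : A) (Θ : Ty₄ A) (p q : Pl A) (c : Fin 3) :
    corner A (twA A σ Θ) (plA A σ p) (plA A σ q) c = twA A σ (corner A Θ p q c) := by
  fin_cases c <;> simp [corner, twA_flipAt]

omit [DecidableEq A] in
/-- Equal halves coordinatewise are preserved by the sheared translation (`|A|` odd). [folklore] -/
theorem half_coord_twA_eq_iff (hA : Odd (Fintype.card A)) (σ : A) (Θ Θ' : Ty₄ A) (n : Fin 4) :
    half A (coord A n (twA A σ Θ)) = half A (coord A n (twA A σ Θ')) ↔ half A (coord A (ρA n) Θ) = half A (coord A (ρA n) Θ') := by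
  rw [coord_twA, coord_twA, half_tw_eq_iff A hA]

omit [DecidableEq A] in
/-- The half of every coordinate moves along. [folklore] -/
theorem half_coord_twA (σ : A) (Θ : Ty₄ A) (n : Fin 4) : half A (coord A n (twA A σ Θ)) = half A (coord A (ρA n) Θ) := by
  rw [coord_twA, half_tw_zero]

/-- **Reducing pairs move with the labels.** [folklore] -/
theorem reducing_twA (hA : Odd (Fintype.card A)) (σ : A) {Θ : Ty₄ A} {p q : Pl A}
    (h : p ≠ q ∧ ∀ c, pot₄ A (corner A Θ p q c) < pot₄ A Θ ∧ ∀ n, half A (coord A n (corner A Θ p q c)) = half A (coord A n Θ)) :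
    plA A σ p ≠ plA A σ q ∧ ∀ c, pot₄ A (corner A (twA A σ Θ) (plA A σ p) (plA A σ q) c) < pot₄ A (twA A σ Θ) ∧
      ∀ n, half A (coord A n (corner A (twA A σ Θ) (plA A σ p) (plA A σ q) c)) = half A (coord A n (twA A σ Θ)) := by
  refine ⟨fun e => h.1 (plA_injective A σ e), fun c => ⟨?_, fun n => ?_⟩⟩
  · rw [corner_twA, pot₄_twA, pot₄_twA]; exact (h.2 c).1
  · rw [corner_twA, half_coord_twA_eq_iff A hA]; exact (h.2 c).2 _

end Potential

end

end Summit.HodgeConjecture.CorCM.Census.BinaryTetrahedral
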